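import Literature.Probability.LatticeModels.FlatBoundaryFrameWindow
import Literature.Probability.LatticeModels.LatticeCorridor
import Literature.Probability.LatticeModels.FlatRayBeurling
import Literature.Probability.RandomPlanarGeometry.InteriorChain
import HarnessLib

/-!
# A priori bounds for the Green function with a flat boundary pole (assembly, part A)

Topic `Literature/Probability/LatticeModels` (the lattice half of the proof of D. Chelkak,
S. Smirnov, *Discrete complex analysis on isoradial graphs*, Adv. Math. 228 (2011), Thm. 3.13,
square-lattice / flat-boundary case, tree fact
`ChelkakSmirnov2011_boundaryNormalisedPoissonKernelLimit`).

Along a sequence of meshes `δ n → 0⁺`, with `V n = {v : meshPoint (δ n) v ∈ D̄}`, poles `b n → y`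
and normalisation points `a n → x` (both with exactly one lattice neighbour outside `V n`, at flat
boundary points `y ≠ x` with orientations `oy`, `ox`), we prove, eventually in `n`:

* `eventually_window_frame` — the lattice window of width `⌊r₀/(4δ)⌋` at the pole, in the frame;
* `eventually_dirichletGreen_le` — **upper bound** `G_{V n}(z, b n) ≤ (64 C_A / d) δ n` at the
  sites `z` with `dist(meshPoint z, y) ≥ d` (`BoundaryPoleGreenBounds.dirichletGreen_le_flatPoleConst_div`);
* `sq_le_dirichletGreen_of_corridor` (static) and `eventually_sq_le_dirichletGreen` — **lower bound**
  `κ δ² ≤ G_{V n}(a n, b n)`: the Harnack corridor `LatticeCorridor.corridorChain` from the window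
  above the pole through the interior chain `InteriorChain.exists_chain_closedBall_subset` to the top
  side of the rectangle at `a n`, `dirichletGreen_chain_ge` and `dirichletGreen_base_ge`;
* `eventually_ratio_le` — the normalised kernel `P n z = G(z, b) δ / G(a, b)` is bounded by `M_d`
  at mesh distance `≥ d` from `y`, uniformly in `n`.

Everything is proved, [folklore] given the cited tree results.
-/

noncomputable section

namespace Literature.Probability.LatticeModels

open _root_.Complex Metric Set _root_.Filter _root_.Topology Orient WeakBeurling Real
open Literature.Probability.RandomPlanarGeometry

/-! ### Geometry of the normal coordinate -/

/-- `nrmC (x + s e + t ν) = nrmC x + t`. [folklore] -/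
theorem nrmC_add_combo (o : Orient) (x : ℂ) (s t : ℝ) :
    nrmC o (x + ((s : ℂ) * e o + (t : ℂ) * ν o)) = nrmC o x + t := by
  have h := nrmC_sub o (x + ((s : ℂ) * e o + (t : ℂ) * ν o)) x
  rw [add_sub_cancel_left, nrmC_combo] at h
  linarith

/-- `|x + s e + t ν - x| ≤ |s| + |t|`. [folklore] -/
theorem norm_combo_le (o : Orient) (s t : ℝ) : ‖(s : ℂ) * e o + (t : ℂ) * ν o‖ ≤ |s| + |t| := by
  calc ‖(s : ℂ) * e o + (t : ℂ) * ν o‖ ≤ ‖(s : ℂ) * e o‖ + ‖(t : ℂ) * ν o‖ := norm_add_le _ _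
    _ = |s| + |t| := by rw [norm_mul, norm_mul, norm_e, norm_ν, mul_one, mul_one, norm_real, norm_real,
        Real.norm_eq_abs, Real.norm_eq_abs]

/-- **A closed disc on the inner side lies in the domain**: if inside `B(x, r₀)` membership in `D`
is `nrmC o x < nrmC o z`, then `closedBall q R ⊆ D` whenever `dist q x + R < r₀` and
`nrmC o x + R < nrmC o q`. [folklore] -/
theorem closedBall_subset_of_nrmC {D : Set ℂ} {x : ℂ} {o : Orient} {r₀ : ℝ}
    (hs : ∀ z, dist z x < r₀ → (z ∈ D ↔ nrmC o x < nrmC o z))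
    {q : ℂ} {R : ℝ} (h1 : dist q x + R < r₀) (h2 : nrmC o x + R < nrmC o q) : closedBall q R ⊆ D := by
  intro z hz
  rw [mem_closedBall] at hz
  refine (hs z ?_).2 ?_
  · calc dist z x ≤ dist z q + dist q x := dist_triangle _ _ _
      _ < r₀ := by linarith
  · have := abs_nrmC_sub_le_norm o z q
    rw [← dist_eq_norm] at this
    have := (abs_le.1 this).1
    linarith

/-- **The point at normal height `t` over the flat boundary point lies in the domain**, with a disc. [folklore] -/
theorem closedBall_combo_subset {D : Set ℂ} {x : ℂ} {o : Orient} {r₀ : ℝ}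
    (hs : ∀ z, dist z x < r₀ → (z ∈ D ↔ nrmC o x < nrmC o z))
    {s t R : ℝ} (h1 : |s| + |t| + R < r₀) (h2 : R < t) :
    closedBall (x + ((s : ℂ) * e o + (t : ℂ) * ν o)) R ⊆ D := by
  apply closedBall_subset_of_nrmC hs
  · rw [dist_eq_norm, add_sub_cancel_left]
    linarith [norm_combo_le o s t]
  · rw [nrmC_add_combo]; linarith

/-! ### The windows, eventually -/

section Eventually

variable {δ : ℕ → ℝ} {D : Set ℂ} {V : ℕ → Finset (Site 2)}

/-- `⌊r₀/(4δ)⌋` is at least `r₀/(8δ)` and at most `r₀/(4δ)` once `δ ≤ r₀/8`. [folklore] -/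
theorem floor_window_bounds {r₀ d : ℝ} (hd : 0 < d) (hdr : d ≤ r₀ / 8) :
    r₀ / (8 * d) ≤ (⌊r₀ / (4 * d)⌋₊ : ℝ) ∧ (⌊r₀ / (4 * d)⌋₊ : ℝ) ≤ r₀ / (4 * d) := by
  have h0 : 0 ≤ r₀ / (4 * d) := by apply div_nonneg <;> linarith
  refine ⟨?_, Nat.floor_le h0⟩
  have h1 := Nat.lt_floor_add_one (r₀ / (4 * d))
  have h2 : (2 : ℝ) ≤ r₀ / (4 * d) := by rw [le_div_iff₀ (by positivity)]; linarith
  have h3 : r₀ / (8 * d) = r₀ / (4 * d) / 2 := by rw [div_div]; ring_nf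
  rw [h3]; linarith

/-- **The lattice window at the pole, eventually** (width `W n = ⌊r₀/(4 δ n)⌋`, in the frame of
the orientation `o` of the flat boundary point `y`). [folklore] -/
theorem eventually_window_frame (o : Orient) (hδ : ∀ n, 0 < δ n) (hδ0 : Tendsto δ atTop (𝓝 0))
    (hV : ∀ n (v : Site 2), v ∈ V n ↔ meshPoint (δ n) v ∈ closure D)
    {y : ℂ} {r₀ : ℝ} (hr₀ : 0 < r₀)
    (hstruct : ∀ z, dist z y < r₀ → (z ∈ closure D ↔ nrmC o y ≤ nrmC o z))
    {b : ℕ → Site 2}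
    (hb : ∀ n, b n ∈ V n ∧ (((zdGraph 2).neighborFinset (b n)).filter (fun u => u ∉ V n)).card = 1)
    (hby : Tendsto (fun n => meshPoint (δ n) (b n)) atTop (𝓝 y)) :
    ∀ᶠ n in atTop, ∀ z' : Site 2, |z' 0 - frame o (b n) 0| ≤ ⌊r₀ / (4 * δ n)⌋₊ →
      |z' 1 - frame o (b n) 1| ≤ ⌊r₀ / (4 * δ n)⌋₊ →
      (z' ∈ (V n).map (frame o).toEmbedding ↔ frame o (b n) 1 ≤ z' 1) := by
  have h1 : ∀ᶠ n in atTop, δ n < r₀ / 8 := hδ0.eventually (gt_mem_nhds (by positivity))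
  have h2 : ∀ᶠ n in atTop, dist (meshPoint (δ n) (b n)) y < r₀ / 4 :=
    (Metric.tendsto_nhds.1 hby) _ (by positivity)
  filter_upwards [h1, h2] with n hn1 hn2
  refine window_frame o (hδ n) (hV n) hstruct (hb n).1 (hb n).2 ?_
  have hW := (floor_window_bounds (hδ n) hn1.le).2
  have hd := hδ n
  have : 2 * δ n * ((⌊r₀ / (4 * δ n)⌋₊ : ℝ) + 1) ≤ r₀ / 2 + 2 * δ n := by
    have := mul_le_mul_of_nonneg_left hW (by positivity : (0 : ℝ) ≤ 2 * δ n)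
    rw [show 2 * δ n * (r₀ / (4 * δ n)) = r₀ / 2 by field_simp; ring] at this
    linarith
  linarith

/-! ### The a priori upper bound, eventually -/

/-- Sup-lattice-distance from the distance of mesh points: if `2δρ ≤ |meshPoint z - meshPoint b|`
then `ρ ≤ |z₀ - b₀|` or `ρ ≤ |z₁ - b₁|`. [folklore] -/
theorem le_abs_sub_or_of_norm_meshPoint {d : ℝ} (hd : 0 < d) {z b : Site 2} {ρ : ℕ}
    (h : 2 * d * ρ ≤ ‖meshPoint d z - meshPoint d b‖) : (ρ : ℤ) ≤ |z 0 - b 0| ∨ (ρ : ℤ) ≤ |z 1 - b 1| := by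
  by_contra hcon
  rw [not_or, not_le, not_le] at hcon
  obtain ⟨h0, h1⟩ := hcon
  have key := dist_meshPoint_le hd.le z b
  rw [dist_eq_norm] at key
  have h0' : |((z 0 - b 0 : ℤ) : ℝ)| < ρ := by
    rw [← Int.cast_abs]; exact_mod_cast h0
  have h1' : |((z 1 - b 1 : ℤ) : ℝ)| < ρ := by
    rw [← Int.cast_abs]; exact_mod_cast h1
  have : d * (|((z 0 - b 0 : ℤ) : ℝ)| + |((z 1 - b 1 : ℤ) : ℝ)|) < d * (ρ + ρ) :=
    mul_lt_mul_of_pos_left (by linarith) hd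
  linarith

/-- **Upper bound, eventually.** With the data above and `0 < d ≤ r₀/4`: eventually in `n`, every
site `z ∈ V n` with `dist(meshPoint z, y) ≥ d` has `G_{V n}(z, b n) ≤ (64 C_A / d) · δ n`
(`C_A = flatPoleConst`). [folklore] -/
theorem eventually_dirichletGreen_le (o : Orient) (hδ : ∀ n, 0 < δ n) (hδ0 : Tendsto δ atTop (𝓝 0))
    (hV : ∀ n (v : Site 2), v ∈ V n ↔ meshPoint (δ n) v ∈ closure D)
    {y : ℂ} {r₀ : ℝ} (hr₀ : 0 < r₀)
    (hstruct : ∀ z, dist z y < r₀ → (z ∈ closure D ↔ nrmC o y ≤ nrmC o z))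
    {b : ℕ → Site 2}
    (hb : ∀ n, b n ∈ V n ∧ (((zdGraph 2).neighborFinset (b n)).filter (fun u => u ∉ V n)).card = 1)
    (hby : Tendsto (fun n => meshPoint (δ n) (b n)) atTop (𝓝 y)) {d : ℝ} (hd : 0 < d) (hdr : d ≤ r₀ / 4) :
    ∀ᶠ n in atTop, ∀ z ∈ V n, d ≤ dist (meshPoint (δ n) z) y →
      dirichletGreen (V n) z (b n) ≤ 64 * flatPoleConst / d * δ n := by
  have h1 : ∀ᶠ n in atTop, δ n < d / 128 := hδ0.eventually (gt_mem_nhds (by positivity))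
  have h2 : ∀ᶠ n in atTop, dist (meshPoint (δ n) (b n)) y < d / 2 :=
    (Metric.tendsto_nhds.1 hby) _ (by positivity)
  filter_upwards [h1, h2, eventually_window_frame o hδ hδ0 hV hr₀ hstruct hb hby] with n hn1 hn2 hwin z hz hdz
  set dn := δ n with hdn
  have hd0 : 0 < dn := hδ n
  -- the scale `ρ`
  set ρ : ℕ := ⌊d / (32 * dn)⌋₊ with hρ
  have hρle : (ρ : ℝ) ≤ d / (32 * dn) := Nat.floor_le (by positivity)
  have hρge : d / (32 * dn) - 1 ≤ ρ := by have := Nat.lt_floor_add_one (d / (32 * dn)); linarith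
  have h64 : (2 : ℝ) ≤ d / (32 * dn) - 1 := by
    rw [le_sub_iff_add_le, le_div_iff₀ (by positivity)]; linarith
  have hρ2 : 2 ≤ ρ := by
    have : (2 : ℝ) ≤ ρ := by linarith
    exact_mod_cast this
  have hρpos : (0 : ℝ) < ρ := by exact_mod_cast (show 0 < ρ by omega)
  have hρge' : d / (64 * dn) ≤ ρ := by
    have : d / (64 * dn) = d / (32 * dn) / 2 := by rw [div_div]; ring_nf
    rw [this]; linarith
  -- `8ρ ≤ W`
  obtain ⟨hWge, -⟩ := floor_window_bounds hd0 (by linarith : dn ≤ r₀ / 8)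
  have hWρ : 8 * ρ ≤ ⌊r₀ / (4 * dn)⌋₊ := by
    have h : (8 : ℝ) * ρ ≤ ⌊r₀ / (4 * dn)⌋₊ := by
      calc (8 : ℝ) * ρ ≤ 8 * (d / (32 * dn)) := by linarith
        _ = d / (4 * dn) := by ring
        _ ≤ r₀ / (8 * dn) := by rw [div_le_div_iff₀ (by positivity) (by positivity)]; nlinarith
        _ ≤ _ := hWge
    exact_mod_cast h
  -- `z` is far from `b n` in the lattice
  have hfar : (ρ : ℤ) ≤ |z 0 - b n 0| ∨ (ρ : ℤ) ≤ |z 1 - b n 1| := by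
    apply le_abs_sub_or_of_norm_meshPoint hd0
    have hzb : d / 2 ≤ ‖meshPoint dn z - meshPoint dn (b n)‖ := by
      have := dist_triangle (meshPoint dn z) (meshPoint dn (b n)) y
      rw [← dist_eq_norm]
      linarith
    calc 2 * dn * ρ ≤ 2 * dn * (d / (32 * dn)) := by nlinarith
      _ = d / 16 := by field_simp; ring
      _ ≤ _ := by linarith
  have key := dirichletGreen_le_flatPoleConst_div_frame' o hρ2 hWρ hwin hz hfar
  calc dirichletGreen (V n) z (b n) ≤ flatPoleConst / ρ := key
    _ ≤ flatPoleConst / (d / (64 * dn)) := by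
        apply div_le_div_of_nonneg_left flatPoleConst_pos.le (by positivity) hρge'
    _ = 64 * flatPoleConst / d * dn := by field_simp

end Eventually

/-! ### The lower bound: the static corridor estimate -/

section Static

variable {δ : ℝ} {V : Finset (Site 2)} {D : Set ℂ} {ox oy : Orient} {a b : Site 2}
  {W t S T k J M : ℕ} {z : ℕ → ℂ} {ε₀ η ℓ : ℝ}

/-- **The corridor lower bound (static form).** Given the two windows (at the pole `b` in the
frame `oy`, at the normalisation point `a` in the frame `ox`, common width `W`), the interior
chain `z 0, …, z J` with discs `closedBall (z j) ε₀ ⊆ D`, and lattice scales `t, S = 6kM, T, k`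
satisfying the listed inequalities, the Green function satisfies
`(1/T - T/S²) · (c/2)^{J+M+3} / (8t) ≤ G_V(a, b)` (`c = maneuverConst`):
`dirichletGreen_chain_ge` along `corridorChain`, `exists_mem_mB_corridorChain` for the top side of
the rectangle at `a`, and `dirichletGreen_base_ge`. [folklore] -/
theorem sq_le_dirichletGreen_of_corridor (hδ : 0 < δ) (hV : ∀ v, v ∈ V ↔ meshPoint δ v ∈ closure D)
    (hwin_y : ∀ z' : Site 2, |z' 0 - frame oy b 0| ≤ W → |z' 1 - frame oy b 1| ≤ W →
      (z' ∈ V.map (frame oy).toEmbedding ↔ frame oy b 1 ≤ z' 1))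
    (hwin_x : ∀ z' : Site 2, |z' 0 - frame ox a 0| ≤ W → |z' 1 - frame ox a 1| ≤ W →
      (z' ∈ V.map (frame ox).toEmbedding ↔ frame ox a 1 ≤ z' 1))
    (hW : 2 ≤ W) (ht : 1 ≤ t) (htW : t + 1 ≤ W) (hWt : 8 * (1 / (π * modeRateConst) + 2 / π) * t ≤ W)
    (hk : 0 < k) (hkt : 48 * k + 2 ≤ t) (htW' : t + 48 * k ≤ W + 1)
    (hzD : ∀ j, j ≤ J → closedBall (z j) ε₀ ⊆ D) (hkε : 96 * k * δ + 2 * δ ≤ ε₀)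
    (hbout : ∃ u : Site 2, ‖meshPoint δ u - meshPoint δ b‖ ≤ δ ∧ u ∉ V)
    (hSM : S = 6 * k * M) (hS : S + 48 * k ≤ W) (hT1 : 48 * k + 1 ≤ T) (hT2 : T + 48 * k ≤ W + 1)
    (hfar : (S : ℤ) + 48 * k < |frame ox b 0 - frame ox a 0| ∨ (T : ℤ) + 48 * k < |frame ox b 1 - frame ox a 1|)
    (h0 : ‖meshPoint δ b + (δ : ℂ) * ((((t : ℤ) - 1 : ℤ) : ℝ) : ℂ) * ν oy - z 0‖ ≤ η)
    (hJ : ‖meshPoint δ a + (δ : ℂ) * ((((-(S : ℤ) : ℤ) : ℝ) : ℂ) * e ox + ((((T : ℤ) - 1 : ℤ) : ℝ) : ℂ) * ν ox) - z J‖ ≤ η)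
    (hz : ∀ j, j < J → dist (z (j + 1)) (z j) ≤ ℓ) (hη : η + δ ≤ 12 * k * δ) (hℓ : ℓ + 2 * δ ≤ 12 * k * δ)
    (hS0 : 0 < S) (hT : 2 ≤ T) :
    (1 / (T : ℝ) - T / (S : ℝ) ^ 2) * ((maneuverConst / 2) ^ (J + 2 + M + 1) / (8 * t)) ≤ dirichletGreen V a b := by
  -- frames
  set σy := frame oy with hσy
  set σx := frame ox with hσx
  set Λ' := V.map σy.toEmbedding with hΛ'
  set Λ'' := V.map σx.toEmbedding with hΛ''
  set ch := corridorChain oy ox δ a b t S T k J M z with hch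
  have hc2 : 0 ≤ maneuverConst / 2 := by linarith [maneuverConst_pos]
  have hc2' : maneuverConst / 2 ≤ 1 := by linarith [maneuverConst_le_one]
  set m : ℝ := (maneuverConst / 2) ^ (J + 2 + M + 1) / (8 * t) with hm
  have hm0 : 0 ≤ m := by positivity
  -- the chain hypotheses
  have hsub : windowFinset (σy b) W ⊆ Λ' := windowFinset_subset_of_window hwin_y
  have hc0 : (ch 0) 0 = σy b 0 := by rw [hch, corridorChain_zero, frameStart_apply_zero]
  have hc1 : (ch 0) 1 = σy b 1 + t - 1 := by rw [hch, corridorChain_zero, frameStart_apply_one]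
  have hSM' : 2 * S = 12 * k * M := by subst hSM; ring
  have hM : 12 * k * M ≤ 2 * S := hSM'.symm.le
  have hM' : 2 * S ≤ 12 * k * M := hSM'.le
  have hboxes : ∀ j, j ≤ J + 2 + M → mW (ch j) k ⊆ (↑Λ' : Set (Site 2)) \ {σy b} := fun j _ =>
    mW_corridorChain_subset hδ hV hwin_y hwin_x hkt htW' hzD hkε hbout hM hS hT1 hT2 hfar j
  have hsteps : ∀ j, j < J + 2 + M → ch (j + 1) ∈ mB (ch j) k := fun j _ =>
    corridorChain_step hδ h0 hJ hz hη hℓ j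
  -- the top side of the rectangle at `a`
  have htop : ∀ w : Site 2, w 1 = (σx a 1 - 1) + T → σx a 0 - S < w 0 → w 0 < σx a 0 - S + 2 * S →
      m ≤ dirichletGreen Λ'' (σx b) w := by
    intro w hw1 hw0 hw0'
    obtain ⟨mi, hmi, hmem⟩ := exists_mem_mB_corridorChain (oy := oy) (δ := δ) (b := b) (t := t) (J := J) (z := z)
      hk hM' (by rw [hw1]) hw0 (by linarith)
    have hchain := dirichletGreen_chain_ge (Λ := Λ') (b := σy b) hW hsub ht htW hWt hk ch (J := J + 2 + mi)
      hc0 hc1 (fun j hj => hboxes j (by omega)) (fun j hj => hsteps j (by omega)) hmem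
    rw [hΛ', hσy, dirichletGreen_map_frame, Equiv.symm_apply_apply] at hchain
    rw [hΛ'', hσx, dirichletGreen_map_frame]
    refine le_trans ?_ hchain
    rw [hm]
    apply div_le_div_of_nonneg_right _ (by positivity)
    exact pow_le_pow_of_le_one hc2 hc2' (by omega)
  -- the rectangle lies in `Λ'' ∖ {σx b}`
  set α : Site 2 := ![σx a 0 - S, σx a 1 - 1] with hα
  have hα0 : α 0 = σx a 0 - S := rfl
  have hα1 : α 1 = σx a 1 - 1 := rfl
  have hRa : rectInterior α (2 * S) T ⊆ (↑Λ'' : Set (Site 2)) \ {σx b} := by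
    refine rectInterior_subset_of_window hwin_x (by omega) (by omega) ?_ hα0 hα1
    rcases hfar with h | h
    · left; omega
    · right; omega
  have hbase := dirichletGreen_base_ge (Λ := Λ'') (b := σx b) (a := σx a) α hS0 hT hRa hm0
    (fun w hw1 hw0 hw0' => htop w (by rw [hw1, hα1]) (by rw [hα0] at hw0; exact hw0)
      (by rw [hα0] at hw0'; linarith)) (by rw [hα0]; ring) (by rw [hα1]; ring)
  rw [hΛ'', hσx, dirichletGreen_map_motion (frame ox) (isLatticeMotion_frame ox)] at hbase
  rw [mul_comm]
  exact hbase

end Static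

/-! ### The lower bound, eventually -/

section Scales

/-- A natural-number inequality from the real one multiplied by `d > 0`. [folklore] -/
private theorem natLe_of_mul_le {m n : ℕ} {d : ℝ} (hd : 0 < d) (h : (m : ℝ) * d ≤ n * d) : m ≤ n := by
  exact_mod_cast le_of_mul_le_mul_right h hd

/-- Floor bounds multiplied out: `c - d ≤ ⌊c/d⌋ d ≤ c`. [folklore] -/
theorem floor_mul_bounds {c d : ℝ} (hc : 0 ≤ c) (hd : 0 < d) :
    c - d ≤ (⌊c / d⌋₊ : ℝ) * d ∧ (⌊c / d⌋₊ : ℝ) * d ≤ c := by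
  have h1 : (⌊c / d⌋₊ : ℝ) ≤ c / d := Nat.floor_le (div_nonneg hc hd.le)
  have h2 : c / d < ⌊c / d⌋₊ + 1 := Nat.lt_floor_add_one _
  rw [div_lt_iff₀ hd] at h2
  rw [le_div_iff₀ hd] at h1
  constructor <;> linarith

/-- `S = 6k ⌊T/(3k)⌋` versus `T`: `S ≤ 2T < S + 6k`. [folklore] -/
theorem sweep_count_bounds {k T : ℕ} (hk : 0 < k) :
    6 * k * (T / (3 * k)) ≤ 2 * T ∧ 2 * T < 6 * k * (T / (3 * k)) + 6 * k := by
  have h1 := Nat.div_add_mod T (3 * k)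
  have h2 := Nat.mod_lt T (show 0 < 3 * k by omega)
  have h3 : 6 * k * (T / (3 * k)) = 2 * (3 * k * (T / (3 * k))) := by ring
  omega

/-- The number of sweep steps is bounded: `T/(3k) ≤ ⌈T₀/ℓ⌉` when `T d ≤ T₀`, `ℓ - d ≤ k d`, `8d ≤ ℓ`. [folklore] -/
theorem sweep_count_le_ceil {d ℓ T₀ : ℝ} {k T : ℕ} (hd : 0 < d) (hℓ : 0 < ℓ) (hT₀ : 0 ≤ T₀) (hk : 0 < k)
    (h8 : 8 * d ≤ ℓ) (hkd' : ℓ - d ≤ k * d) (hTd : (T : ℝ) * d ≤ T₀) : T / (3 * k) ≤ ⌈T₀ / ℓ⌉₊ := by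
  have h1 : ((T / (3 * k) : ℕ) : ℝ) ≤ (T : ℝ) / ((3 * k : ℕ) : ℝ) := Nat.cast_div_le
  push_cast at h1
  have hkr : (0 : ℝ) < k := by exact_mod_cast hk
  have h2 : (T : ℝ) / (3 * k) ≤ T₀ / ℓ := by
    rw [div_le_div_iff₀ (by positivity) hℓ]
    refine le_of_mul_le_mul_right ?_ hd
    have e1 : (T : ℝ) * ℓ * d = ℓ * (T * d) := by ring
    have e2 : T₀ * (3 * (k : ℝ)) * d = 3 * T₀ * (k * d) := by ring
    rw [e1, e2]
    have h3 : ℓ * ((T : ℝ) * d) ≤ ℓ * T₀ := mul_le_mul_of_nonneg_left hTd hℓ.le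
    have h4 : 3 * T₀ * (ℓ - d) ≤ 3 * T₀ * (k * d) := mul_le_mul_of_nonneg_left hkd' (by positivity)
    nlinarith
  have h3 : T₀ / ℓ ≤ ⌈T₀ / ℓ⌉₊ := Nat.le_ceil _
  exact_mod_cast h1.trans (h2.trans h3)

variable {d ℓ t₀ T₀ r₀ ε₀ Cw : ℝ} {k t T W S : ℕ}

/-- **The scales of the corridor, I** (`W, t, k`). [folklore] -/
theorem corridor_scales₁ (hd : 0 < d) (hCw : 0 < Cw)
    (h8 : 8 * d ≤ ℓ) (hℓt : 200 * ℓ ≤ t₀) (ht₀ : t₀ ≤ r₀ / 64) (hCwt₀ : 64 * Cw * t₀ ≤ r₀)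
    (hkd' : ℓ - d ≤ k * d) (hkd : (k : ℝ) * d ≤ ℓ) (htd' : t₀ - d ≤ t * d) (htd : (t : ℝ) * d ≤ t₀)
    (hWd' : r₀ / 4 - d ≤ W * d) :
    2 ≤ W ∧ 1 ≤ t ∧ t + 1 ≤ W ∧ 8 * Cw * (t : ℝ) ≤ W ∧ 0 < k ∧ 48 * k + 2 ≤ t ∧ t + 48 * k ≤ W + 1 := by
  refine ⟨?_, ?_, ?_, ?_, ?_, ?_, ?_⟩
  · exact natLe_of_mul_le hd (by push_cast; linarith)
  · exact natLe_of_mul_le hd (by push_cast; linarith)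
  · exact natLe_of_mul_le hd (by push_cast; linarith)
  · refine le_of_mul_le_mul_right ?_ hd
    have h1 : 8 * Cw * (t : ℝ) * d = 8 * Cw * (t * d) := by ring
    have h2 : 8 * Cw * ((t : ℝ) * d) ≤ 8 * Cw * t₀ := mul_le_mul_of_nonneg_left htd (by positivity)
    rw [h1]; linarith
  · have : (0 : ℝ) < k := by
      by_contra hcon
      push Not at hcon
      have : (k : ℝ) * d ≤ 0 := mul_nonpos_of_nonpos_of_nonneg hcon hd.le
      linarith
    exact_mod_cast this
  · exact natLe_of_mul_le hd (by push_cast; linarith)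
  · exact natLe_of_mul_le hd (by push_cast; linarith)

/-- **The scales of the corridor, II** (`T, S`). [folklore] -/
theorem corridor_scales₂ (hd : 0 < d) (h8 : 8 * d ≤ ℓ) (hℓT : 200 * ℓ ≤ T₀) (hT₀ : T₀ = r₀ / 16)
    (hkd : (k : ℝ) * d ≤ ℓ) (hTd' : T₀ - d ≤ T * d) (hTd : (T : ℝ) * d ≤ T₀)
    (hWd' : r₀ / 4 - d ≤ W * d) (hS2T : S ≤ 2 * T) (hS2T' : 2 * T < S + 6 * k) :
    48 * k + 1 ≤ T ∧ T + 48 * k ≤ W + 1 ∧ 2 ≤ T ∧ S + 48 * k ≤ W ∧ 0 < S ∧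
      3 * (T : ℝ) ≤ 2 * S ∧ (S : ℝ) * d ≤ 2 * T₀ := by
  have hSr : (S : ℝ) ≤ 2 * T := by exact_mod_cast hS2T
  have hSr' : 2 * (T : ℝ) ≤ S + 6 * k := by exact_mod_cast hS2T'.le
  have hSd : (S : ℝ) * d ≤ 2 * (T * d) := by
    have := mul_le_mul_of_nonneg_right hSr hd.le; linarith
  have hSd' : 2 * ((T : ℝ) * d) ≤ S * d + 6 * (k * d) := by
    have := mul_le_mul_of_nonneg_right hSr' hd.le; linarith
  refine ⟨?_, ?_, ?_, ?_, ?_, ?_, ?_⟩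
  · exact natLe_of_mul_le hd (by push_cast; linarith)
  · exact natLe_of_mul_le hd (by push_cast; linarith)
  · exact natLe_of_mul_le hd (by push_cast; linarith)
  · exact natLe_of_mul_le hd (by push_cast; linarith)
  · have : (0 : ℝ) < S := by
      by_contra hcon
      push Not at hcon
      have : (S : ℝ) * d ≤ 0 := mul_nonpos_of_nonpos_of_nonneg hcon hd.le
      linarith
    exact_mod_cast this
  · refine le_of_mul_le_mul_right ?_ hd
    linarith
  · linarith

/-- **The junction constants**: `7ℓ + d ≤ 12kd`, `ℓ + 2d ≤ 12kd`, `96kd + 2d ≤ ε₀`. [folklore] -/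
theorem corridor_scales₃ (h8 : 8 * d ≤ ℓ) (hℓε : 200 * ℓ ≤ ε₀)
    (hkd' : ℓ - d ≤ k * d) (hkd : (k : ℝ) * d ≤ ℓ) :
    7 * ℓ + d ≤ 12 * k * d ∧ ℓ + 2 * d ≤ 12 * k * d ∧ 96 * k * d + 2 * d ≤ ε₀ := by
  refine ⟨by linarith, by linarith, by linarith⟩

end Scales

section Lower

variable {δ : ℕ → ℝ} {D : Set ℂ} {V : ℕ → Finset (Site 2)}

/-- The junction at the pole: `|meshPoint b + d(t-1)ν - (y + t₀ν)| ≤ dist(meshPoint b, y) + 2d`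
when `t₀ - d ≤ t d ≤ t₀`. [folklore] -/
theorem norm_junction_pole (o : Orient) {d t₀ : ℝ} {t : ℕ} (mb y : ℂ) (htd' : t₀ - d ≤ t * d)
    (htd : (t : ℝ) * d ≤ t₀) :
    ‖mb + (d : ℂ) * ((((t : ℤ) - 1 : ℤ) : ℝ) : ℂ) * ν o - (y + ((((0 : ℝ)) : ℂ) * e o + (t₀ : ℂ) * ν o))‖ ≤
      dist mb y + 2 * d := by
  have heq : mb + (d : ℂ) * ((((t : ℤ) - 1 : ℤ) : ℝ) : ℂ) * ν o - (y + ((((0 : ℝ)) : ℂ) * e o + (t₀ : ℂ) * ν o)) =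
      (mb - y) + (((d * ((t : ℝ) - 1) - t₀ : ℝ)) : ℂ) * ν o := by
    push_cast; ring
  rw [heq]
  calc ‖(mb - y) + (((d * ((t : ℝ) - 1) - t₀ : ℝ)) : ℂ) * ν o‖
      ≤ ‖mb - y‖ + ‖(((d * ((t : ℝ) - 1) - t₀ : ℝ)) : ℂ) * ν o‖ := norm_add_le _ _
    _ ≤ dist mb y + 2 * d := by
        rw [norm_mul, norm_ν, mul_one, norm_real, Real.norm_eq_abs, ← dist_eq_norm]
        have : |d * ((t : ℝ) - 1) - t₀| ≤ 2 * d := by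
          rw [abs_le]; constructor <;> nlinarith
        linarith

/-- The junction at the normalisation point:
`|meshPoint a + d(-S e + (T-1)ν) - (x - 2T₀ e + T₀ ν)| ≤ dist(meshPoint a, x) + 6kd + 4d`. [folklore] -/
theorem norm_junction_norm (o : Orient) {d T₀ : ℝ} {S T k : ℕ} (ma x : ℂ) (hTd' : T₀ - d ≤ T * d)
    (hTd : (T : ℝ) * d ≤ T₀) (hSd : (S : ℝ) * d ≤ 2 * (T * d)) (hSd' : 2 * ((T : ℝ) * d) ≤ S * d + 6 * (k * d)) :
    ‖ma + (d : ℂ) * ((((-(S : ℤ) : ℤ) : ℝ) : ℂ) * e o + ((((T : ℤ) - 1 : ℤ) : ℝ) : ℂ) * ν o) -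
        (x + (((-(2 * T₀) : ℝ) : ℂ) * e o + (T₀ : ℂ) * ν o))‖ ≤ dist ma x + 6 * (k * d) + 4 * d := by
  have heq : ma + (d : ℂ) * ((((-(S : ℤ) : ℤ) : ℝ) : ℂ) * e o + ((((T : ℤ) - 1 : ℤ) : ℝ) : ℂ) * ν o) -
      (x + (((-(2 * T₀) : ℝ) : ℂ) * e o + (T₀ : ℂ) * ν o)) =
      (ma - x) + ((((2 * T₀ - d * S : ℝ)) : ℂ) * e o + (((d * ((T : ℝ) - 1) - T₀ : ℝ)) : ℂ) * ν o) := by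
    push_cast; ring
  rw [heq]
  have h1 : |2 * T₀ - d * S| ≤ 6 * (k * d) + 2 * d := by
    rw [abs_le]; constructor <;> nlinarith
  have h2 : |d * ((T : ℝ) - 1) - T₀| ≤ 2 * d := by
    rw [abs_le]; constructor <;> nlinarith
  calc ‖(ma - x) + ((((2 * T₀ - d * S : ℝ)) : ℂ) * e o + (((d * ((T : ℝ) - 1) - T₀ : ℝ)) : ℂ) * ν o)‖
      ≤ ‖ma - x‖ + (‖(((2 * T₀ - d * S : ℝ)) : ℂ) * e o‖ + ‖(((d * ((T : ℝ) - 1) - T₀ : ℝ)) : ℂ) * ν o‖) :=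
        norm_add_le_of_le le_rfl (norm_add_le _ _)
    _ ≤ dist ma x + 6 * (k * d) + 4 * d := by
        rw [norm_mul, norm_mul, norm_ν, norm_e, mul_one, mul_one, norm_real, norm_real, Real.norm_eq_abs,
          Real.norm_eq_abs, ← dist_eq_norm]
        linarith

/-- **The constant**: with `M ≤ M₀`, `3T ≤ 2S`, `T d ≤ T₀`, `t d ≤ t₀`,
`κ d² ≤ (1/T - T/S²) (c/2)^{J+M+3}/(8t)` for `κ = 5 (c/2)^{J+M₀+3} / (72 T₀ t₀)`. [folklore] -/
theorem corridor_constant_le {d T₀ t₀ : ℝ} {t T S M M₀ J : ℕ} (hd : 0 < d) (hT₀ : 0 < T₀) (ht₀ : 0 < t₀)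
    (hT : 0 < T) (ht : 0 < t) (hMM₀ : M ≤ M₀) (hS32 : 3 * (T : ℝ) ≤ 2 * S)
    (hTd : (T : ℝ) * d ≤ T₀) (htd : (t : ℝ) * d ≤ t₀) :
    5 * (maneuverConst / 2) ^ (J + 2 + M₀ + 1) / (72 * T₀ * t₀) * d ^ 2 ≤
      (1 / (T : ℝ) - T / (S : ℝ) ^ 2) * ((maneuverConst / 2) ^ (J + 2 + M + 1) / (8 * t)) := by
  have hc2 : 0 ≤ maneuverConst / 2 := by linarith [maneuverConst_pos]
  have hc2' : maneuverConst / 2 ≤ 1 := by linarith [maneuverConst_le_one]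
  have hc20 : 0 < maneuverConst / 2 := by linarith [maneuverConst_pos]
  have hTr : (0 : ℝ) < T := by exact_mod_cast hT
  have htr : (0 : ℝ) < t := by exact_mod_cast ht
  have hSr : (0 : ℝ) < S := by linarith
  have hpow : (maneuverConst / 2) ^ (J + 2 + M₀ + 1) ≤ (maneuverConst / 2) ^ (J + 2 + M + 1) :=
    pow_le_pow_of_le_one hc2 hc2' (by omega)
  have hgeo : 5 / (9 * (T : ℝ)) ≤ 1 / (T : ℝ) - T / (S : ℝ) ^ 2 := by
    have h1 : (T : ℝ) / (S : ℝ) ^ 2 ≤ 4 / (9 * T) := by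
      rw [div_le_div_iff₀ (by positivity) (by positivity)]; nlinarith
    have h2 : 5 / (9 * (T : ℝ)) = 1 / T - 4 / (9 * T) := by field_simp; ring
    linarith
  have h1T : d / T₀ ≤ 1 / (T : ℝ) := by
    rw [div_le_div_iff₀ hT₀ hTr]; nlinarith
  have h1t : d / t₀ ≤ 1 / (t : ℝ) := by
    rw [div_le_div_iff₀ ht₀ htr]; nlinarith
  have hpow0 : 0 < (maneuverConst / 2) ^ (J + 2 + M₀ + 1) := pow_pos hc20 _
  calc 5 * (maneuverConst / 2) ^ (J + 2 + M₀ + 1) / (72 * T₀ * t₀) * d ^ 2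
      = (5 / 9 * (d / T₀)) * ((maneuverConst / 2) ^ (J + 2 + M₀ + 1) * (1 / 8 * (d / t₀))) := by
        field_simp; ring
    _ ≤ (5 / 9 * (1 / (T : ℝ))) * ((maneuverConst / 2) ^ (J + 2 + M + 1) * (1 / 8 * (1 / (t : ℝ)))) := by
        apply mul_le_mul (by linarith) _ (by positivity) (by positivity)
        exact mul_le_mul hpow (by linarith) (by positivity) (pow_nonneg hc2 _)
    _ = 5 / (9 * (T : ℝ)) * ((maneuverConst / 2) ^ (J + 2 + M + 1) / (8 * t)) := by
        field_simp
    _ ≤ (1 / (T : ℝ) - T / (S : ℝ) ^ 2) * ((maneuverConst / 2) ^ (J + 2 + M + 1) / (8 * t)) :=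
        mul_le_mul_of_nonneg_right hgeo (by positivity)

/-- **Lower bound, eventually.** Along the sequence, `κ δ² ≤ G_{V n}(a n, b n)` for a constant
`κ > 0` depending only on `D`, `x`, `y`, `r₀` and the orientations (via the interior chain):
the static estimate `sq_le_dirichletGreen_of_corridor` with the scales
`t = ⌊t₀/δ⌋, T = ⌊T₀/δ⌋, k = ⌊ℓ/δ⌋, M = T/(3k), S = 6kM`. [folklore] -/
theorem eventually_sq_le_dirichletGreen (hD : IsOpen D) (hDc : IsConnected D)
    (hδ : ∀ n, 0 < δ n) (hδ0 : Tendsto δ atTop (𝓝 0))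
    (hV : ∀ n (v : Site 2), v ∈ V n ↔ meshPoint (δ n) v ∈ closure D)
    {x y : ℂ} {ox oy : Orient} {r₀ : ℝ} (hr₀ : 0 < r₀) (hxy : 4 * r₀ ≤ dist x y)
    (hsx : ∀ z, dist z x < r₀ → (z ∈ closure D ↔ nrmC ox x ≤ nrmC ox z))
    (hsx' : ∀ z, dist z x < r₀ → (z ∈ D ↔ nrmC ox x < nrmC ox z))
    (hsy : ∀ z, dist z y < r₀ → (z ∈ closure D ↔ nrmC oy y ≤ nrmC oy z))
    (hsy' : ∀ z, dist z y < r₀ → (z ∈ D ↔ nrmC oy y < nrmC oy z))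
    {a b : ℕ → Site 2}
    (ha : ∀ n, a n ∈ V n ∧ (((zdGraph 2).neighborFinset (a n)).filter (fun u => u ∉ V n)).card = 1)
    (hb : ∀ n, b n ∈ V n ∧ (((zdGraph 2).neighborFinset (b n)).filter (fun u => u ∉ V n)).card = 1)
    (hax : Tendsto (fun n => meshPoint (δ n) (a n)) atTop (𝓝 x))
    (hby : Tendsto (fun n => meshPoint (δ n) (b n)) atTop (𝓝 y)) :
    ∃ κ : ℝ, 0 < κ ∧ ∀ᶠ n in atTop, κ * δ n ^ 2 ≤ dirichletGreen (V n) (a n) (b n) := by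
  -- constants
  set Cw : ℝ := 1 / (π * modeRateConst) + 2 / π with hCw
  have hCw0 : 0 < Cw := by have := modeRateConst_pos; positivity
  set t₀ : ℝ := r₀ / (64 * Cw + 64) with ht₀
  have ht₀0 : 0 < t₀ := by positivity
  have ht₀eq : t₀ * (64 * Cw + 64) = r₀ := by rw [ht₀]; field_simp
  have ht₀le : t₀ ≤ r₀ / 64 := by
    rw [le_div_iff₀ (by norm_num : (0 : ℝ) < 64)]; nlinarith
  have hCwt₀ : 64 * Cw * t₀ ≤ r₀ := by nlinarith
  set T₀ : ℝ := r₀ / 16 with hT₀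
  have hT₀0 : 0 < T₀ := by positivity
  -- the endpoints of the interior chain
  set p : ℂ := y + ((((0 : ℝ)) : ℂ) * e oy + (t₀ : ℂ) * ν oy) with hp
  set q : ℂ := x + (((-(2 * T₀) : ℝ) : ℂ) * e ox + (T₀ : ℂ) * ν ox) with hq
  have hpD : p ∈ D :=
    closedBall_combo_subset hsy' (R := 0) (by rw [abs_zero, abs_of_pos ht₀0]; linarith) ht₀0
      (mem_closedBall_self le_rfl)
  have hqD : q ∈ D :=
    closedBall_combo_subset hsx' (R := 0)
      (by rw [abs_neg, abs_of_pos (by positivity), abs_of_pos hT₀0, hT₀]; linarith) hT₀0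
      (mem_closedBall_self le_rfl)
  obtain ⟨ε₀, hε₀, hchain⟩ :=
    Literature.Probability.RandomPlanarGeometry.exists_chain_closedBall_subset hD hDc hpD hqD
  set ℓ : ℝ := min (min ε₀ t₀) T₀ / 200 with hℓ
  have hℓ0 : 0 < ℓ := by positivity
  have hℓε : 200 * ℓ ≤ ε₀ := by
    have : min (min ε₀ t₀) T₀ ≤ ε₀ := (min_le_left _ _).trans (min_le_left _ _)
    rw [hℓ]; linarith
  have hℓt : 200 * ℓ ≤ t₀ := by
    have : min (min ε₀ t₀) T₀ ≤ t₀ := (min_le_left _ _).trans (min_le_right _ _)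
    rw [hℓ]; linarith
  have hℓT : 200 * ℓ ≤ T₀ := by
    have : min (min ε₀ t₀) T₀ ≤ T₀ := min_le_right _ _
    rw [hℓ]; linarith
  obtain ⟨J, z, hz0, hzJ, hzD, hzℓ⟩ := hchain ℓ hℓ0
  set M₀ : ℕ := ⌈T₀ / ℓ⌉₊ with hM₀
  refine ⟨5 * (maneuverConst / 2) ^ (J + 2 + M₀ + 1) / (72 * T₀ * t₀),
    by have := maneuverConst_pos; positivity, ?_⟩
  -- eventually
  have e1 : ∀ᶠ n in atTop, δ n < ℓ / 8 := hδ0.eventually (gt_mem_nhds (by positivity))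
  have e2 : ∀ᶠ n in atTop, dist (meshPoint (δ n) (a n)) x < ℓ / 2 :=
    (Metric.tendsto_nhds.1 hax) _ (by positivity)
  have e3 : ∀ᶠ n in atTop, dist (meshPoint (δ n) (b n)) y < ℓ / 2 :=
    (Metric.tendsto_nhds.1 hby) _ (by positivity)
  filter_upwards [e1, e2, e3, eventually_window_frame oy hδ hδ0 hV hr₀ hsy hb hby,
    eventually_window_frame ox hδ hδ0 hV hr₀ hsx ha hax] with n hn1 hn2 hn3 hwin_y hwin_x
  set d := δ n with hd
  have hd0 : 0 < d := hδ n
  have hdℓ : 8 * d ≤ ℓ := by linarith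
  -- the scales and their bounds
  obtain ⟨hkd', hkd⟩ := floor_mul_bounds hℓ0.le hd0
  obtain ⟨htd', htd⟩ := floor_mul_bounds ht₀0.le hd0
  obtain ⟨hTd', hTd⟩ := floor_mul_bounds hT₀0.le hd0
  obtain ⟨hWd', hWd⟩ := floor_mul_bounds (show (0 : ℝ) ≤ r₀ / 4 by positivity) hd0
  rw [show r₀ / 4 / d = r₀ / (4 * d) by rw [div_div]] at hWd' hWd
  set k : ℕ := ⌊ℓ / d⌋₊ with hk
  set t : ℕ := ⌊t₀ / d⌋₊ with ht
  set T : ℕ := ⌊T₀ / d⌋₊ with hT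
  set W : ℕ := ⌊r₀ / (4 * d)⌋₊ with hW
  obtain ⟨hW2, ht1, htW, hWt, hk0, hkt, htW'⟩ := corridor_scales₁ hd0 hCw0 hdℓ hℓt ht₀le hCwt₀ hkd' hkd htd' htd hWd'
  obtain ⟨hS2T, hS2T'⟩ := sweep_count_bounds (T := T) hk0
  set M : ℕ := T / (3 * k) with hM
  set S : ℕ := 6 * k * M with hS
  obtain ⟨hT1, hT2, hT2', hS48, hS0, hS32, hSd⟩ :=
    corridor_scales₂ hd0 hdℓ hℓT hT₀ hkd hTd' hTd hWd' hS2T hS2T'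
  obtain ⟨hη, hℓ', hkε⟩ := corridor_scales₃ (k := k) hdℓ hℓε hkd' hkd
  -- `b` is far from `a`
  have hfarR : 2 * d * ((S : ℝ) + T + 48 * k) < ‖meshPoint d (b n) - meshPoint d (a n)‖ := by
    have h4 := dist_triangle4 x (meshPoint d (a n)) (meshPoint d (b n)) y
    have e1' : dist x (meshPoint d (a n)) = dist (meshPoint d (a n)) x := dist_comm _ _
    have e2' : dist (meshPoint d (a n)) (meshPoint d (b n)) = ‖meshPoint d (b n) - meshPoint d (a n)‖ := by
      rw [dist_comm, dist_eq_norm]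
    rw [e1', e2'] at h4
    have e3' : 2 * d * ((S : ℝ) + T + 48 * k) = 2 * (S * d) + 2 * (T * d) + 96 * (k * d) := by ring
    rw [e3']
    linarith
  have hfar : (S : ℤ) + 48 * k < |frame ox (b n) 0 - frame ox (a n) 0| ∨
      (T : ℤ) + 48 * k < |frame ox (b n) 1 - frame ox (a n) 1| := by
    have hT0 : (0 : ℝ) ≤ T := by positivity
    have hS0' : (0 : ℝ) ≤ S := by positivity
    rcases lt_abs_frame_sub_or ox hd0 hfarR with h | h
    · left
      have : ((S : ℝ) + 48 * k) < |((frame ox (b n) 0 - frame ox (a n) 0 : ℤ) : ℝ)| := by linarith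
      rw [← Int.cast_abs] at this
      exact_mod_cast this
    · right
      have : ((T : ℝ) + 48 * k) < |((frame ox (b n) 1 - frame ox (a n) 1 : ℤ) : ℝ)| := by linarith
      rw [← Int.cast_abs] at this
      exact_mod_cast this
  -- the junctions
  have h0 : ‖meshPoint d (b n) + (d : ℂ) * ((((t : ℤ) - 1 : ℤ) : ℝ) : ℂ) * ν oy - z 0‖ ≤ 7 * ℓ := by
    rw [hz0, hp]
    have := norm_junction_pole oy (meshPoint d (b n)) y htd' htd
    linarith
  have hSdd : (S : ℝ) * d ≤ 2 * (T * d) := by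
    have : (S : ℝ) ≤ 2 * T := by exact_mod_cast hS2T
    have := mul_le_mul_of_nonneg_right this hd0.le; linarith
  have hSdd' : 2 * ((T : ℝ) * d) ≤ S * d + 6 * (k * d) := by
    have : 2 * (T : ℝ) ≤ S + 6 * k := by exact_mod_cast hS2T'.le
    have := mul_le_mul_of_nonneg_right this hd0.le; linarith
  have hJ' : ‖meshPoint d (a n) + (d : ℂ) * ((((-(S : ℤ) : ℤ) : ℝ) : ℂ) * e ox +
      ((((T : ℤ) - 1 : ℤ) : ℝ) : ℂ) * ν ox) - z J‖ ≤ 7 * ℓ := by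
    rw [hzJ, hq]
    have := norm_junction_norm ox (meshPoint d (a n)) x hTd' hTd hSdd hSdd'
    linarith
  have hbout := exists_not_mem_norm_sub_le (V := V n) hd0 (hb n).2
  -- the static estimate
  have key := sq_le_dirichletGreen_of_corridor (oy := oy) (ox := ox) (J := J) (M := M) (z := z) hd0 (hV n)
    hwin_y hwin_x hW2 ht1 htW hWt hk0 hkt htW' hzD hkε hbout rfl hS48 hT1 hT2 hfar h0 hJ' hzℓ hη hℓ' hS0 hT2'
  refine le_trans ?_ key
  -- compare the constants
  have hMM₀ : M ≤ M₀ := sweep_count_le_ceil hd0 hℓ0 hT₀0.le hk0 hdℓ hkd' hTd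
  exact corridor_constant_le hd0 hT₀0 ht₀0 (by omega) (by omega) hMM₀ hS32 hTd htd

end Lower

/-! ### The normalised kernel `P n z = G(z, b) δ / G(a, b)` -/

section Ratio

variable {δ : ℕ → ℝ} {D : Set ℂ} {V : ℕ → Finset (Site 2)}

/-- `P ≥ 0`. [folklore] -/
theorem ratio_nonneg (Λ : Finset (Site 2)) (a b z : Site 2) {d : ℝ} (hd : 0 ≤ d) :
    0 ≤ dirichletGreen Λ z b * d / dirichletGreen Λ a b :=
  div_nonneg (mul_nonneg (dirichletGreen_nonneg two_pos Λ z b) hd) (dirichletGreen_nonneg two_pos Λ a b)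

/-- `P = 0` off `Λ`. [folklore] -/
theorem ratio_of_not_mem (Λ : Finset (Site 2)) (a b : Site 2) {z : Site 2} (hz : z ∉ Λ) (d : ℝ) :
    dirichletGreen Λ z b * d / dirichletGreen Λ a b = 0 := by
  rw [dirichletGreen_of_not_mem_left Λ hz, zero_mul, zero_div]

/-- `P` is lattice-harmonic on `Λ ∖ {b}`. [folklore] -/
theorem latticeLaplacian_ratio (Λ : Finset (Site 2)) (a b : Site 2) (d : ℝ) {v : Site 2}
    (hv : v ∈ (↑Λ : Set (Site 2)) \ {b}) :
    latticeLaplacian (fun z => dirichletGreen Λ z b * d / dirichletGreen Λ a b) v = 0 := by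
  have heq : (fun z => dirichletGreen Λ z b * d / dirichletGreen Λ a b) =
      fun z => d / dirichletGreen Λ a b * dirichletGreen Λ b z := by
    funext z; rw [dirichletGreen_comm Λ z b]; ring
  rw [heq, latticeLaplacian_const_mul, isLatticeHarmonicOn_dirichletGreen Λ b v hv, mul_zero]

/-- **A site whose closed mesh disc lies in `D` is an interior site**: it lies in `V` and is not
the pole (which has a neighbour outside `V`); hence `P` is harmonic there. [folklore] -/
theorem mem_diff_of_closedBall_subset {d : ℝ} (hd : 0 < d) {Λ : Finset (Site 2)}
    (hV : ∀ v : Site 2, v ∈ Λ ↔ meshPoint d v ∈ closure D) {b : Site 2}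
    (hb : (((zdGraph 2).neighborFinset b).filter (fun u => u ∉ Λ)).card = 1) {v : Site 2}
    (h : closedBall (meshPoint d v) d ⊆ D) : v ∈ (↑Λ : Set (Site 2)) \ {b} := by
  refine ⟨Finset.mem_coe.2 ((hV v).2 (subset_closure (h (mem_closedBall_self hd.le)))), ?_⟩
  rintro rfl
  obtain ⟨u, hu, huV⟩ := exists_not_mem_norm_sub_le hd hb
  exact huV ((hV u).2 (subset_closure (h (by rw [mem_closedBall, dist_eq_norm]; exact hu))))

/-- **The uniform bound on the normalised kernel away from the pole**: with the upper bound
`eventually_dirichletGreen_le` and a lower bound `κ δ² ≤ G(a, b)`, eventually in `n`,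
`P n z ≤ 64 C_A / (κ d)` at every site `z` with `dist(meshPoint z, y) ≥ d` (`0 < d ≤ r₀/4`). [folklore] -/
theorem eventually_ratio_le (o : Orient) (hδ : ∀ n, 0 < δ n) (hδ0 : Tendsto δ atTop (𝓝 0))
    (hV : ∀ n (v : Site 2), v ∈ V n ↔ meshPoint (δ n) v ∈ closure D)
    {y : ℂ} {r₀ : ℝ} (hr₀ : 0 < r₀)
    (hstruct : ∀ z, dist z y < r₀ → (z ∈ closure D ↔ nrmC o y ≤ nrmC o z))
    {b : ℕ → Site 2}
    (hb : ∀ n, b n ∈ V n ∧ (((zdGraph 2).neighborFinset (b n)).filter (fun u => u ∉ V n)).card = 1)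
    (hby : Tendsto (fun n => meshPoint (δ n) (b n)) atTop (𝓝 y))
    {a : ℕ → Site 2} {κ : ℝ} (hκ : 0 < κ)
    (hlow : ∀ᶠ n in atTop, κ * δ n ^ 2 ≤ dirichletGreen (V n) (a n) (b n))
    {d : ℝ} (hd : 0 < d) (hdr : d ≤ r₀ / 4) :
    ∀ᶠ n in atTop, ∀ z : Site 2, d ≤ dist (meshPoint (δ n) z) y →
      dirichletGreen (V n) z (b n) * δ n / dirichletGreen (V n) (a n) (b n) ≤ 64 * flatPoleConst / (κ * d) := by
  filter_upwards [eventually_dirichletGreen_le o hδ hδ0 hV hr₀ hstruct hb hby hd hdr, hlow] with n hup hlo z hz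
  have hC := flatPoleConst_pos
  by_cases hzV : z ∈ V n
  · have h1 := hup z hzV hz
    have hd0 := hδ n
    have hG : 0 < dirichletGreen (V n) (a n) (b n) := lt_of_lt_of_le (by positivity) hlo
    rw [div_le_iff₀ hG]
    calc dirichletGreen (V n) z (b n) * δ n ≤ 64 * flatPoleConst / d * δ n * δ n :=
          mul_le_mul_of_nonneg_right h1 hd0.le
      _ = 64 * flatPoleConst / (κ * d) * (κ * δ n ^ 2) := by field_simp
      _ ≤ 64 * flatPoleConst / (κ * d) * dirichletGreen (V n) (a n) (b n) :=
          mul_le_mul_of_nonneg_left hlo (by positivity)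
  · rw [ratio_of_not_mem _ _ _ hzV]; positivity

end Ratio

/-! ### Decay near the boundary away from the pole (weak Beurling in an exterior quadrant) -/

section Decay

variable {δ : ℕ → ℝ} {V : ℕ → Finset (Site 2)}

/-- The anchor of the exterior box: the nearest site to `ζ + 3d(s₁ + s₂ i)` lies in the open
exterior quadrant, `2d` inside, within `7d` of `ζ`. [folklore] -/
theorem anchor_bounds {d : ℝ} (hd : 0 < d) {s₁ s₂ : ℝ} (hs₁ : s₁ = 1 ∨ s₁ = -1) (hs₂ : s₂ = 1 ∨ s₂ = -1)
    (ζ : ℂ) :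
    2 * d ≤ s₁ * ((meshPoint d (nearestSite d (ζ + 3 * d * (s₁ + s₂ * I)))).re - ζ.re) ∧
      2 * d ≤ s₂ * ((meshPoint d (nearestSite d (ζ + 3 * d * (s₁ + s₂ * I)))).im - ζ.im) ∧
      dist (meshPoint d (nearestSite d (ζ + 3 * d * (s₁ + s₂ * I)))) ζ ≤ 7 * d := by
  set m := meshPoint d (nearestSite d (ζ + 3 * d * (s₁ + s₂ * I))) with hm
  have hdist : dist m (ζ + 3 * d * (s₁ + s₂ * I)) ≤ d := dist_meshPoint_nearestSite_le hd _
  have hn : ‖m - (ζ + 3 * d * (s₁ + s₂ * I))‖ ≤ d := by rwa [← dist_eq_norm]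
  have hre := (abs_re_le_norm (m - (ζ + 3 * d * (s₁ + s₂ * I)))).trans hn
  have him := (abs_im_le_norm (m - (ζ + 3 * d * (s₁ + s₂ * I)))).trans hn
  simp only [sub_re, sub_im, add_re, add_im, mul_re, mul_im, I_re, I_im, ofReal_re, ofReal_im,
    mul_zero, mul_one, sub_zero, add_zero, zero_add] at hre him
  norm_num at hre him
  have hs1sq : s₁ * s₁ = 1 := by rcases hs₁ with rfl | rfl <;> norm_num
  have hs2sq : s₂ * s₂ = 1 := by rcases hs₂ with rfl | rfl <;> norm_num
  have habs1 : |s₁| = 1 := by rcases hs₁ with rfl | rfl <;> norm_num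
  have habs2 : |s₂| = 1 := by rcases hs₂ with rfl | rfl <;> norm_num
  refine ⟨?_, ?_, ?_⟩
  · have h1 : s₁ * (m.re - ζ.re) = 3 * d * (s₁ * s₁) + s₁ * (m.re - (ζ.re + 3 * d * s₁)) := by ring
    rw [hs1sq, mul_one] at h1
    have h2 : |s₁ * (m.re - (ζ.re + 3 * d * s₁))| ≤ d := by rw [abs_mul, habs1, one_mul]; exact hre
    have h3 := (abs_le.1 h2).1
    linarith
  · have h1 : s₂ * (m.im - ζ.im) = 3 * d * (s₂ * s₂) + s₂ * (m.im - (ζ.im + 3 * d * s₂)) := by ring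
    rw [hs2sq, mul_one] at h1
    have h2 : |s₂ * (m.im - (ζ.im + 3 * d * s₂))| ≤ d := by rw [abs_mul, habs2, one_mul]; exact him
    have h3 := (abs_le.1 h2).1
    linarith
  · have e1 : ‖(3 : ℂ) * d * s₁‖ = 3 * d := by
      rw [norm_mul, norm_mul, norm_real, norm_real, Real.norm_eq_abs, Real.norm_eq_abs, habs1,
        abs_of_pos hd]
      simp
    have e2 : ‖(3 : ℂ) * d * (s₂ * I)‖ = 3 * d := by
      rw [norm_mul, norm_mul, norm_mul, norm_I, norm_real, norm_real, Real.norm_eq_abs, Real.norm_eq_abs,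
        habs2, abs_of_pos hd]
      simp
    calc dist m ζ ≤ dist m (ζ + 3 * d * (s₁ + s₂ * I)) + dist (ζ + 3 * d * (s₁ + s₂ * I)) ζ := dist_triangle _ _ _
      _ ≤ d + (3 * d + 3 * d) := by
          refine add_le_add hdist ?_
          rw [dist_eq_norm, add_sub_cancel_left, mul_add]
          calc ‖(3 : ℂ) * d * s₁ + 3 * d * (s₂ * I)‖ ≤ ‖(3 : ℂ) * d * s₁‖ + ‖(3 : ℂ) * d * (s₂ * I)‖ := norm_add_le _ _
            _ = 3 * d + 3 * d := by rw [e1, e2]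
      _ = 7 * d := by ring

/-- **Weak Beurling decay near a boundary point with an exterior quadrant** (static form). Let
inside `B(ζ, r_q)` the open quadrant `{s₁(Re z - Re ζ) > 0, s₂(Im z - Im ζ) > 0}` miss `D̄`,
`V = {v : meshPoint d v ∈ D̄}`, `P` lattice-harmonic on `V ∖ {b}`, `≤ 0` off `V`, `≤ A` at the
sites of `V` within `Rζ` of `ζ`, the pole `b` farther than `Rζ` from `ζ`. Then for
`ρ ≤ R`, `(2R + 9)d ≤ Rζ`, `(R + 9)d ≤ r_q`: on `V ∩ sqBox p ρ` (`p` the anchor site)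
`P ≤ A · C_B ((ρ+1)/(R+1))^β` (`FlatRayBeurling.le_mul_rpow_of_flat_ray` with the horizontal ray
from `p` into the quadrant). [folklore] -/
theorem le_mul_rpow_near_quadrant {d : ℝ} (hd : 0 < d) {Λ : Finset (Site 2)} {D : Set ℂ}
    (hV : ∀ v : Site 2, v ∈ Λ ↔ meshPoint d v ∈ closure D)
    {ζ : ℂ} {s₁ s₂ : ℝ} (hs₁ : s₁ = 1 ∨ s₁ = -1) (hs₂ : s₂ = 1 ∨ s₂ = -1) {rq : ℝ}
    (hquad : ∀ z : ℂ, s₁ * ζ.re < s₁ * z.re → s₂ * ζ.im < s₂ * z.im → dist z ζ < rq → z ∉ closure D)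
    {P : Site 2 → ℝ} {b : Site 2} (hharm : IsLatticeHarmonicOn P ((↑Λ : Set (Site 2)) \ {b}))
    (h0 : ∀ w : Site 2, w ∉ Λ → P w ≤ 0) {A Rζ : ℝ} (hA : 0 < A)
    (h1 : ∀ w ∈ Λ, dist (meshPoint d w) ζ ≤ Rζ → P w ≤ A) (hbfar : Rζ < dist (meshPoint d b) ζ)
    {R ρ : ℕ} (hρR : ρ ≤ R) (hR : (2 * R + 9) * d ≤ Rζ) (hRq : (R + 9) * d ≤ rq)
    {z : Site 2} (hzV : z ∈ Λ) (hz : z ∈ sqBox (nearestSite d (ζ + 3 * d * (s₁ + s₂ * I))) ρ) :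
    P z ≤ A * (beurlingConst * (((ρ : ℝ) + 1) / ((R : ℝ) + 1)) ^ beurlingExp) := by
  set p := nearestSite d (ζ + 3 * d * (s₁ + s₂ * I)) with hp
  obtain ⟨hpre, hpim, hpdist⟩ := anchor_bounds hd hs₁ hs₂ ζ
  rw [← hp] at hpre hpim hpdist
  have hs1sq : s₁ * s₁ = 1 := by rcases hs₁ with rfl | rfl <;> norm_num
  have habs1 : |s₁| = 1 := by rcases hs₁ with rfl | rfl <;> norm_num
  -- mesh points of the box are close to `ζ`
  have hbox : ∀ (n : ℕ) (w : Site 2), w ∈ sqBox p n → dist (meshPoint d w) ζ ≤ 2 * n * d + 7 * d := by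
    intro n w hw
    rw [mem_sqBox] at hw
    have h1 := dist_meshPoint_le hd.le w p
    have h2 : |((w 0 - p 0 : ℤ) : ℝ)| ≤ n := by rw [← Int.cast_abs]; exact_mod_cast hw.1
    have h3 : |((w 1 - p 1 : ℤ) : ℝ)| ≤ n := by rw [← Int.cast_abs]; exact_mod_cast hw.2
    have h4 : d * (|((w 0 - p 0 : ℤ) : ℝ)| + |((w 1 - p 1 : ℤ) : ℝ)|) ≤ d * (n + n) :=
      mul_le_mul_of_nonneg_left (add_le_add h2 h3) hd.le
    calc dist (meshPoint d w) ζ ≤ dist (meshPoint d w) (meshPoint d p) + dist (meshPoint d p) ζ := dist_triangle _ _ _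
      _ ≤ 2 * n * d + 7 * d := by linarith
  -- the ray
  obtain ⟨k, hk⟩ : ∃ k : Fin 4, ∀ j : ℕ, meshPoint d (p + j • cornerUnit k) = meshPoint d p + ((s₁ * j * d : ℝ) : ℂ) := by
    rcases hs₁ with rfl | rfl
    · refine ⟨0, fun j => ?_⟩
      apply Complex.ext
      · simp [meshPoint_re, cornerUnit]; ring
      · simp [meshPoint_im, cornerUnit]
    · refine ⟨2, fun j => ?_⟩
      apply Complex.ext
      · simp [meshPoint_re, cornerUnit]; ring
      · simp [meshPoint_im, cornerUnit]
  have hray : ∀ j : ℕ, j ≤ R + 1 → p + j • cornerUnit k ∉ Λ := by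
    intro j hj hjV
    rw [hV, hk j] at hjV
    have hjd : (0 : ℝ) ≤ j * d := by positivity
    refine hquad _ ?_ ?_ ?_ hjV
    · have e : (meshPoint d p + ((s₁ * j * d : ℝ) : ℂ)).re = (meshPoint d p).re + s₁ * j * d := by simp
      have e' : s₁ * ((meshPoint d p).re + s₁ * j * d) = s₁ * (meshPoint d p).re + (s₁ * s₁) * (j * d) := by ring
      rw [e, e', hs1sq, one_mul]
      linarith
    · have e : (meshPoint d p + ((s₁ * j * d : ℝ) : ℂ)).im = (meshPoint d p).im := by simp
      rw [e]; linarith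
    · have hj' : (j : ℝ) ≤ R + 1 := by exact_mod_cast hj
      have hjd' : (j : ℝ) * d ≤ (R + 1) * d := mul_le_mul_of_nonneg_right hj' hd.le
      calc dist (meshPoint d p + ((s₁ * j * d : ℝ) : ℂ)) ζ ≤ dist (meshPoint d p + ((s₁ * j * d : ℝ) : ℂ)) (meshPoint d p) +
            dist (meshPoint d p) ζ := dist_triangle _ _ _
        _ ≤ j * d + 7 * d := by
            refine add_le_add ?_ hpdist
            rw [dist_eq_norm, add_sub_cancel_left, norm_real, Real.norm_eq_abs, abs_mul, abs_mul, habs1, one_mul,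
              abs_of_nonneg (Nat.cast_nonneg j), abs_of_pos hd]
        _ < rq := by linarith
  -- `b` is not in the big box; subharmonicity
  have hbR : b ∉ sqBox p R := fun hbR => by
    have := hbox R b hbR
    have : (2 * R + 9) * d = 2 * R * d + 9 * d := by ring
    linarith
  have hsub : IsLatticeSubharmonicOn P ((↑Λ : Set (Site 2)) ∩ sqBox p R) := by
    intro v hv
    have hvb : v ≠ b := fun h => hbR (h ▸ hv.2)
    exact (hharm v ⟨hv.1, hvb⟩).ge
  -- boundary values on the outer boundary of the box part
  have h1' : ∀ w ∈ latticeOuterBoundary ((↑Λ : Set (Site 2)) ∩ sqBox p R), P w ≤ A := by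
    intro w hw
    by_cases hwV : w ∈ Λ
    · rw [mem_latticeOuterBoundary_iff] at hw
      obtain ⟨-, v, hv, hadj⟩ := hw
      have hwbox : w ∈ sqBox p (R + 1) := mem_sqBox_succ_of_adj hv.2 hadj
      refine h1 w hwV ((hbox (R + 1) w (by exact_mod_cast hwbox)).trans ?_)
      push_cast
      linarith
    · exact (h0 w hwV).trans hA.le
  exact le_mul_rpow_of_flat_ray le_rfl hray hsub hA h1' h0 hzV hz hρR

/-- Sup-distance of two sites from the distance of their mesh points. [folklore] -/
private theorem abs_sub_le_of_norm_meshPoint_le' {d : ℝ} (hd : 0 < d) {v v' : Site 2} {R : ℝ}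
    (h : ‖meshPoint d v - meshPoint d v'‖ ≤ d * R) :
    |((v 0 - v' 0 : ℤ) : ℝ)| ≤ R ∧ |((v 1 - v' 1 : ℤ) : ℝ)| ≤ R := by
  have hre := (abs_re_le_norm _).trans h
  have him := (abs_im_le_norm _).trans h
  rw [sub_re, meshPoint_re, meshPoint_re, ← mul_sub, abs_mul, abs_of_pos hd] at hre
  rw [sub_im, meshPoint_im, meshPoint_im, ← mul_sub, abs_mul, abs_of_pos hd] at him
  push_cast
  exact ⟨le_of_mul_le_mul_left hre hd, le_of_mul_le_mul_left him hd⟩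

/-- The scales of the decay estimate: `ρ ≤ R`, `(2R+9)δ ≤ Rζ`, `(R+9)δ ≤ r_q`. [folklore] -/
theorem decay_scales {dn ρ₀ r₃ rq d Rζ : ℝ} {ρ R : ℕ} (hdn : 0 < dn) (hdn1 : dn < ρ₀ / 8)
    (hρ₀r : ρ₀ ≤ r₃ / 4) (hr₃q : r₃ ≤ rq) (hr₃d : r₃ ≤ d / 4) (hRζ : d ≤ Rζ)
    (hρd : (ρ : ℝ) * dn ≤ ρ₀ + 8 * dn) (hRd : (R : ℝ) * dn ≤ r₃ - 9 * dn) (hRd' : r₃ - 10 * dn ≤ (R : ℝ) * dn) :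
    ρ ≤ R ∧ (2 * R + 9) * dn ≤ Rζ ∧ (R + 9) * dn ≤ rq := by
  refine ⟨natLe_of_mul_le hdn (by linarith), ?_, ?_⟩
  · have : (2 * (R : ℝ) + 9) * dn = 2 * (R * dn) + 9 * dn := by ring
    rw [this]; linarith
  · have : ((R : ℝ) + 9) * dn = R * dn + 9 * dn := by ring
    rw [this]; linarith

/-- The Beurling ratio of the decay estimate: `(ρ+1)/(R+1) ≤ 4ρ₀/r₃`. [folklore] -/
theorem decay_ratio_le {dn ρ₀ r₃ : ℝ} {ρ R : ℕ} (hdn : 0 < dn) (hr₃ : 0 < r₃) (hρ₀ : 0 < ρ₀)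
    (hdn1 : dn < ρ₀ / 8) (hdn2 : dn < r₃ / 32)
    (hρd : (ρ : ℝ) * dn ≤ ρ₀ + 8 * dn) (hRd' : r₃ - 10 * dn ≤ (R : ℝ) * dn) :
    ((ρ : ℝ) + 1) / ((R : ℝ) + 1) ≤ 4 * ρ₀ / r₃ := by
  have hRpos : (0 : ℝ) < R + 1 := by positivity
  rw [div_le_iff₀ hRpos]
  refine le_of_mul_le_mul_right ?_ hdn
  have h1 : ((ρ : ℝ) + 1) * dn ≤ ρ₀ + 9 * dn := by nlinarith
  have h2 : r₃ - 9 * dn ≤ ((R : ℝ) + 1) * dn := by nlinarith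
  have h5 : 4 * ρ₀ / r₃ * (r₃ - 9 * dn) ≤ 4 * ρ₀ / r₃ * (((R : ℝ) + 1) * dn) :=
    mul_le_mul_of_nonneg_left h2 (by positivity)
  have h6 : 4 * ρ₀ / r₃ * (r₃ - 9 * dn) = 4 * ρ₀ - 36 * (ρ₀ * dn) / r₃ := by field_simp; ring
  have h7 : 36 * (ρ₀ * dn) / r₃ ≤ 36 * (ρ₀ * (r₃ / 32)) / r₃ := by
    apply div_le_div_of_nonneg_right _ hr₃.le; nlinarith
  have h8 : 36 * (ρ₀ * (r₃ / 32)) / r₃ = 36 / 32 * ρ₀ := by field_simp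
  calc ((ρ : ℝ) + 1) * dn ≤ ρ₀ + 9 * dn := h1
    _ ≤ 4 * ρ₀ - 36 * (ρ₀ * (r₃ / 32)) / r₃ := by rw [h8]; linarith
    _ ≤ 4 * ρ₀ - 36 * (ρ₀ * dn) / r₃ := by linarith
    _ = 4 * ρ₀ / r₃ * (r₃ - 9 * dn) := h6.symm
    _ ≤ 4 * ρ₀ / r₃ * (((R : ℝ) + 1) * dn) := h5
    _ = 4 * ρ₀ / r₃ * ((R : ℝ) + 1) * dn := by ring

/-- **Decay of the normalised kernel near every boundary point other than the pole, eventually.**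
For a Jordan domain with rectilinear boundary, `ζ ∈ ∂D ∖ {y}` and `ε > 0` there is `ρ₀ > 0` with:
eventually in `n`, `P n z ≤ ε` at all sites `z ∈ V n` whose mesh point is within `ρ₀` of `ζ`
(`le_mul_rpow_near_quadrant` in the uniform exterior quadrant
`JordanDomain.exists_uniform_exterior_quadrant`, with `A = M_d + 1` from `eventually_ratio_le`,
`d = min(dist(ζ,y)/2, r₀/4)`). [folklore] -/
theorem eventually_ratio_le_near (Dj : JordanDomain)
    (hrect : ∃ S : Finset (ℂ × ℂ), (∀ q ∈ S, q.1.re = q.2.re ∨ q.1.im = q.2.im) ∧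
      frontier Dj.carrier ⊆ ⋃ q ∈ S, segment ℝ q.1 q.2)
    (o : Orient) (hδ : ∀ n, 0 < δ n) (hδ0 : Tendsto δ atTop (𝓝 0))
    (hV : ∀ n (v : Site 2), v ∈ V n ↔ meshPoint (δ n) v ∈ closure Dj.carrier)
    {y : ℂ} {r₀ : ℝ} (hr₀ : 0 < r₀)
    (hstruct : ∀ z, dist z y < r₀ → (z ∈ closure Dj.carrier ↔ nrmC o y ≤ nrmC o z))
    {b : ℕ → Site 2}
    (hb : ∀ n, b n ∈ V n ∧ (((zdGraph 2).neighborFinset (b n)).filter (fun u => u ∉ V n)).card = 1)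
    (hby : Tendsto (fun n => meshPoint (δ n) (b n)) atTop (𝓝 y))
    {a : ℕ → Site 2} {κ : ℝ} (hκ : 0 < κ)
    (hlow : ∀ᶠ n in atTop, κ * δ n ^ 2 ≤ dirichletGreen (V n) (a n) (b n))
    {ζ : ℂ} (hζ : ζ ∈ frontier Dj.carrier) (hζy : ζ ≠ y) {ε : ℝ} (hε : 0 < ε) :
    ∃ ρ₀ > 0, ∀ᶠ n in atTop, ∀ z ∈ V n, dist (meshPoint (δ n) z) ζ < ρ₀ →
      dirichletGreen (V n) z (b n) * δ n / dirichletGreen (V n) (a n) (b n) ≤ ε := by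
  have hζy' : 0 < dist ζ y := dist_pos.2 hζy
  set d : ℝ := min (dist ζ y / 2) (r₀ / 4) with hd
  have hd0 : 0 < d := by positivity
  have hd1 : d ≤ dist ζ y / 2 := min_le_left _ _
  have hd2 : d ≤ r₀ / 4 := min_le_right _ _
  have hC := flatPoleConst_pos
  set A : ℝ := 64 * flatPoleConst / (κ * d) + 1 with hA
  have hA0 : 0 < A := by positivity
  obtain ⟨rq, hrq, hquadAll⟩ := Dj.exists_uniform_exterior_quadrant hrect
  obtain ⟨s₁, s₂, hs₁, hs₂, hquad⟩ := hquadAll ζ hζ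
  set r₃ : ℝ := min rq (d / 4) with hr₃
  have hr₃0 : 0 < r₃ := by positivity
  have hr₃q : r₃ ≤ rq := min_le_left _ _
  have hr₃d : r₃ ≤ d / 4 := min_le_right _ _
  have hCB := beurlingConst_pos
  have hβ := beurlingExp_pos
  set θ : ℝ := min 1 (ε / (A * beurlingConst)) with hθ
  have hθ0 : 0 < θ := by positivity
  have hθ1 : θ ≤ 1 := min_le_left _ _
  have hθε : θ ≤ ε / (A * beurlingConst) := min_le_right _ _
  set u : ℝ := θ ^ (1 / beurlingExp) with hu
  have hu0 : 0 < u := Real.rpow_pos_of_pos hθ0 _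
  have hu1 : u ≤ 1 := Real.rpow_le_one hθ0.le hθ1 (by positivity)
  have huβ : u ^ beurlingExp = θ := by
    rw [hu, ← Real.rpow_mul hθ0.le, one_div_mul_cancel hβ.ne', Real.rpow_one]
  set ρ₀ : ℝ := r₃ * u / 4 with hρ₀
  have hρ₀0 : 0 < ρ₀ := by positivity
  have hρ₀r : ρ₀ ≤ r₃ / 4 := by
    rw [hρ₀]; have := mul_le_mul_of_nonneg_left hu1 hr₃0.le; linarith
  refine ⟨ρ₀, hρ₀0, ?_⟩
  have e1 : ∀ᶠ n in atTop, δ n < min (ρ₀ / 8) (r₃ / 32) := hδ0.eventually (gt_mem_nhds (by positivity))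
  have e2 : ∀ᶠ n in atTop, dist (meshPoint (δ n) (b n)) y < d / 2 :=
    (Metric.tendsto_nhds.1 hby) _ (by positivity)
  filter_upwards [e1, e2, eventually_ratio_le o hδ hδ0 hV hr₀ hstruct hb hby hκ hlow hd0 hd2] with n hn1 hn2 hP z hzV hzζ
  set dn := δ n with hdn
  have hdn0 : 0 < dn := hδ n
  have hdn1 : dn < ρ₀ / 8 := lt_of_lt_of_le hn1 (min_le_left _ _)
  have hdn2 : dn < r₃ / 32 := lt_of_lt_of_le hn1 (min_le_right _ _)
  -- scales
  obtain ⟨hFd', hFd⟩ := floor_mul_bounds hr₃0.le hdn0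
  obtain ⟨hGd', hGd⟩ := floor_mul_bounds hρ₀0.le hdn0
  set F : ℕ := ⌊r₃ / dn⌋₊ with hF
  set G : ℕ := ⌊ρ₀ / dn⌋₊ with hG
  have h9 : 9 ≤ F := natLe_of_mul_le hdn0 (by push_cast; linarith)
  set R : ℕ := F - 9 with hR
  set ρ : ℕ := G + 8 with hρ
  have hRr : (R : ℝ) = F - 9 := by rw [hR, Nat.cast_sub h9]; norm_num
  have hRd : (R : ℝ) * dn ≤ r₃ - 9 * dn := by rw [hRr]; linarith
  have hRd' : r₃ - 10 * dn ≤ (R : ℝ) * dn := by rw [hRr]; linarith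
  have hρd : (ρ : ℝ) * dn ≤ ρ₀ + 8 * dn := by rw [hρ]; push_cast; linarith
  -- the normalised kernel
  set P : Site 2 → ℝ := fun w => dirichletGreen (V n) w (b n) * dn / dirichletGreen (V n) (a n) (b n) with hPdef
  have hharm : IsLatticeHarmonicOn P ((↑(V n) : Set (Site 2)) \ {b n}) := fun v hv =>
    latticeLaplacian_ratio _ _ _ _ hv
  have h0 : ∀ w : Site 2, w ∉ V n → P w ≤ 0 := fun w hw => (ratio_of_not_mem _ _ _ hw dn).le
  have h1 : ∀ w ∈ V n, dist (meshPoint dn w) ζ ≤ dist ζ y - d → P w ≤ A := by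
    intro w _ hw
    have hfar : d ≤ dist (meshPoint dn w) y := by
      have := dist_triangle ζ (meshPoint dn w) y
      rw [dist_comm ζ (meshPoint dn w)] at this
      linarith
    have := hP w hfar
    rw [hA]; linarith
  have hbfar : dist ζ y - d < dist (meshPoint dn (b n)) ζ := by
    have := dist_triangle ζ (meshPoint dn (b n)) y
    rw [dist_comm ζ (meshPoint dn (b n))] at this
    linarith
  obtain ⟨hρR, hRbig, hRq⟩ := decay_scales (Rζ := dist ζ y - d) hdn0 hdn1 hρ₀r hr₃q hr₃d (by linarith) hρd hRd hRd'
  -- `z` lies in the small box about the anchor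
  obtain ⟨-, -, hpdist⟩ := anchor_bounds hdn0 hs₁ hs₂ ζ
  have hz : z ∈ sqBox (nearestSite dn (ζ + 3 * dn * (s₁ + s₂ * I))) ρ := by
    have hn : ‖meshPoint dn z - meshPoint dn (nearestSite dn (ζ + 3 * dn * (s₁ + s₂ * I)))‖ ≤ dn * (ρ₀ / dn + 7) := by
      have e : dn * (ρ₀ / dn + 7) = ρ₀ + 7 * dn := by field_simp
      rw [e, ← dist_eq_norm]
      have := dist_triangle (meshPoint dn z) ζ (meshPoint dn (nearestSite dn (ζ + 3 * dn * (s₁ + s₂ * I))))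
      rw [dist_comm ζ] at this
      linarith
    obtain ⟨h0', h1'⟩ := abs_sub_le_of_norm_meshPoint_le' hdn0 hn
    have hlt : ρ₀ / dn + 7 < ρ := by
      rw [hρ, hG]; push_cast; have := Nat.lt_floor_add_one (ρ₀ / dn); linarith
    rw [mem_sqBox]
    constructor
    · have : |((z 0 - (nearestSite dn (ζ + 3 * dn * (s₁ + s₂ * I))) 0 : ℤ) : ℝ)| ≤ ρ := by linarith
      rw [← Int.cast_abs] at this; exact_mod_cast this
    · have : |((z 1 - (nearestSite dn (ζ + 3 * dn * (s₁ + s₂ * I))) 1 : ℤ) : ℝ)| ≤ ρ := by linarith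
      rw [← Int.cast_abs] at this; exact_mod_cast this
  have key := le_mul_rpow_near_quadrant hdn0 (hV n) hs₁ hs₂ hquad hharm h0 hA0 h1 hbfar hρR hRbig hRq hzV hz
  -- the Beurling factor is small
  have hratio : ((ρ : ℝ) + 1) / ((R : ℝ) + 1) ≤ u := by
    have e : u = 4 * ρ₀ / r₃ := by rw [hρ₀]; field_simp
    rw [e]
    exact decay_ratio_le hdn0 hr₃0 hρ₀0 hdn1 hdn2 hρd hRd'
  have hpow : (((ρ : ℝ) + 1) / ((R : ℝ) + 1)) ^ beurlingExp ≤ θ := by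
    rw [← huβ]
    exact Real.rpow_le_rpow (by positivity) hratio hβ.le
  calc P z ≤ A * (beurlingConst * (((ρ : ℝ) + 1) / ((R : ℝ) + 1)) ^ beurlingExp) := key
    _ ≤ A * (beurlingConst * θ) := by
        apply mul_le_mul_of_nonneg_left _ hA0.le
        exact mul_le_mul_of_nonneg_left hpow hCB.le
    _ ≤ A * (beurlingConst * (ε / (A * beurlingConst))) := by
        apply mul_le_mul_of_nonneg_left _ hA0.le
        exact mul_le_mul_of_nonneg_left hθε hCB.le
    _ = ε := by field_simp

end Decay

end Literature.Probability.LatticeModels
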